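import Summits.Ventures.CertifiedArithmetic.LowPrec.SRCertificatesFP4
import HarnessLib

/-!
# Stochastic rounding into a finite format: inner products (two-stage SR) — exact mean and variance

HONEST FRAMING: certified error envelopes and provably optimal rounding/accumulation schemes for
low-precision formats under stated cost models; every table by two implementations; no hardware or
vendor claims.

The inner-product / matrix–vector case of [ConnollyHighamMary2021, Thm. 4.13] in a FINITE format with
saturation: `ŝ₀ = s`, `ŝₖ₊₁ = SR(ŝₖ + SR(cₖ))`, where `cₖ` is the exact product `xₖ·yₖ` (any element of
`K`), first SR-rounded into `F` (saturating mode-2 SR) and then accumulated by a second, fresh SR.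
As in `SRAccumulation`, no measure theory: `ipExp F c n f s = E[f(ŝₙ)]` is the backward recursion over
the finite outcome tree (now with four branches per step), exact in `K` and `decide`-evaluable.

* `ipExp_id_of_noSat` — if no branch saturates (`IPNoSat`: every product `cₖ` and every pre-rounding
  sum on every branch lies in `[min F, max F]`) then `E[ŝₙ] = s + ∑ cₖ` exactly (through subnormals and
  ties): the finite-format form of CHM21 Thm 4.13 for inner products;
* `ipExp_sq_sub` — exact variance identity `E[(ŝₙ − a)²] = ipVar + (s + ∑ cₖ − a)²`, where `ipVar`
  adds, per step, the expected product-rounding variance and the expected sum-rounding variance;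
* `ipVar_le` — `ipVar ≤ n (G_p² + G_s²)/4` from branch-wise gap bounds, and the Chebyshev envelope
  `ipExp_prob_dev_ge_le`: `P(|ŝₙ − (s + ∑ cₖ)| ≥ t) ≤ n (G_p² + G_s²)/(4t²)`;
* FP4 kernel instances.
-/

namespace Summit.Ventures.CertifiedArithmetic.LowPrec.SR

open Literature.ComputerArithmetic.ConnollyHighamMary2021
open Finset

variable {K : Type*} [Field K] [LinearOrder K] [IsStrictOrderedRing K]

/-! ### The two-stage step and the backward recursion -/

/-- One inner-product step from running sum `s` with exact product `c`: `E[f(SR(s + SR(c)))]`. -/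
def ipStep (F : Finset K) (s c : K) (f : K → K) : K := step F c (fun a => step F (s + a) f)

/-- `ipExp F c n f s = E[f(ŝₙ)]` for `ŝ₀ = s`, `ŝₖ₊₁ = SR(ŝₖ + SR(c k))`. -/
def ipExp (F : Finset K) : (ℕ → K) → ℕ → (K → K) → K → K
  | _, 0, f, s => f s
  | c, n + 1, f, s => ipStep F s (c 0) (ipExp F (fun i => c (i + 1)) n f)

/-- Accumulated variance: per step, the product-rounding variance `v_F(c̄ₖ)` plus the expected
sum-rounding variance `E[v_F(ŝₖ + SR(cₖ))]`, summed in expectation over the branches. -/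
def ipVar (F : Finset K) : (ℕ → K) → ℕ → K → K
  | _, 0, _ => 0
  | c, n + 1, s => srVar F (clamp F (c 0)) + step F (c 0) (fun a => srVar F (clamp F (s + a)))
      + ipStep F s (c 0) (ipVar F (fun i => c (i + 1)) n)

/-- `IPNoSat F c n s`: no product and no pre-rounding sum on any branch leaves the hull of `F`. -/
def IPNoSat (F : Finset K) : (ℕ → K) → ℕ → K → Prop
  | _, 0, _ => True
  | c, n + 1, s => InHull F (c 0)
      ∧ (InHull F (s + up F (c 0)) ∧ IPNoSat F (fun i => c (i + 1)) n (up F (s + up F (c 0)))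
          ∧ IPNoSat F (fun i => c (i + 1)) n (dn F (s + up F (c 0))))
      ∧ (InHull F (s + dn F (c 0)) ∧ IPNoSat F (fun i => c (i + 1)) n (up F (s + dn F (c 0)))
          ∧ IPNoSat F (fun i => c (i + 1)) n (dn F (s + dn F (c 0))))

/-- `IPGapLE F Gp Gs c n s`: on every branch the product candidates have gap `≤ Gp` and the sum
candidates have gap `≤ Gs`. -/
def IPGapLE (F : Finset K) (Gp Gs : K) : (ℕ → K) → ℕ → K → Prop
  | _, 0, _ => True
  | c, n + 1, s => (roundUp F (clamp F (c 0)) - roundDown F (clamp F (c 0)) ≤ Gp)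
      ∧ ((roundUp F (clamp F (s + up F (c 0))) - roundDown F (clamp F (s + up F (c 0))) ≤ Gs)
          ∧ IPGapLE F Gp Gs (fun i => c (i + 1)) n (up F (s + up F (c 0)))
          ∧ IPGapLE F Gp Gs (fun i => c (i + 1)) n (dn F (s + up F (c 0))))
      ∧ ((roundUp F (clamp F (s + dn F (c 0))) - roundDown F (clamp F (s + dn F (c 0))) ≤ Gs)
          ∧ IPGapLE F Gp Gs (fun i => c (i + 1)) n (up F (s + dn F (c 0)))
          ∧ IPGapLE F Gp Gs (fun i => c (i + 1)) n (dn F (s + dn F (c 0))))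

/-- Boolean evaluator of `IPNoSat`. -/
def ipNoSatB (F : Finset K) : (ℕ → K) → ℕ → K → Bool
  | _, 0, _ => true
  | c, n + 1, s => decide (InHull F (c 0))
      && (decide (InHull F (s + up F (c 0))) && ipNoSatB F (fun i => c (i + 1)) n (up F (s + up F (c 0)))
          && ipNoSatB F (fun i => c (i + 1)) n (dn F (s + up F (c 0))))
      && (decide (InHull F (s + dn F (c 0))) && ipNoSatB F (fun i => c (i + 1)) n (up F (s + dn F (c 0)))
          && ipNoSatB F (fun i => c (i + 1)) n (dn F (s + dn F (c 0))))

omit [IsStrictOrderedRing K] in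
/-- `ipNoSatB` computes `IPNoSat`. -/
theorem ipNoSatB_iff (F : Finset K) (c : ℕ → K) (n : ℕ) (s : K) :
    ipNoSatB F c n s = true ↔ IPNoSat F c n s := by
  induction n generalizing c s with
  | zero => simp [ipNoSatB, IPNoSat]
  | succ n ih => simp [ipNoSatB, IPNoSat, ih, Bool.and_eq_true, and_assoc]

/-- `IPNoSat` is decidable (via `ipNoSatB`). -/
instance instDecidableIPNoSat (F : Finset K) (c : ℕ → K) (n : ℕ) (s : K) :
    Decidable (IPNoSat F c n s) :=
  decidable_of_iff _ (ipNoSatB_iff F c n s)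

/-- Boolean evaluator of `IPGapLE`. -/
def ipGapLEB (F : Finset K) (Gp Gs : K) : (ℕ → K) → ℕ → K → Bool
  | _, 0, _ => true
  | c, n + 1, s => decide (roundUp F (clamp F (c 0)) - roundDown F (clamp F (c 0)) ≤ Gp)
      && (decide (roundUp F (clamp F (s + up F (c 0))) - roundDown F (clamp F (s + up F (c 0))) ≤ Gs)
          && ipGapLEB F Gp Gs (fun i => c (i + 1)) n (up F (s + up F (c 0)))
          && ipGapLEB F Gp Gs (fun i => c (i + 1)) n (dn F (s + up F (c 0))))
      && (decide (roundUp F (clamp F (s + dn F (c 0))) - roundDown F (clamp F (s + dn F (c 0))) ≤ Gs)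
          && ipGapLEB F Gp Gs (fun i => c (i + 1)) n (up F (s + dn F (c 0)))
          && ipGapLEB F Gp Gs (fun i => c (i + 1)) n (dn F (s + dn F (c 0))))

omit [IsStrictOrderedRing K] in
/-- `ipGapLEB` computes `IPGapLE`. -/
theorem ipGapLEB_iff (F : Finset K) (Gp Gs : K) (c : ℕ → K) (n : ℕ) (s : K) :
    ipGapLEB F Gp Gs c n s = true ↔ IPGapLE F Gp Gs c n s := by
  induction n generalizing c s with
  | zero => simp [ipGapLEB, IPGapLE]
  | succ n ih => simp [ipGapLEB, IPGapLE, ih, Bool.and_eq_true, and_assoc]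

/-- `IPGapLE` is decidable (via `ipGapLEB`). -/
instance instDecidableIPGapLE (F : Finset K) (Gp Gs : K) (c : ℕ → K) (n : ℕ) (s : K) :
    Decidable (IPGapLE F Gp Gs c n s) :=
  decidable_of_iff _ (ipGapLEB_iff F Gp Gs c n s)

/-! ### Linearity, monotonicity -/

omit [IsStrictOrderedRing K] in
/-- Linearity of `E[f(ŝₙ)]` in `f` (sums). -/
theorem ipExp_add (F : Finset K) (c : ℕ → K) (n : ℕ) (f g : K → K) (s : K) :
    ipExp F c n (fun t => f t + g t) s = ipExp F c n f s + ipExp F c n g s := by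
  induction n generalizing c s with
  | zero => rfl
  | succ n ih =>
      simp only [ipExp, ipStep]
      rw [← step_add]
      refine step_congr F _ ?_ ?_ <;> (rw [← step_add]; exact step_congr F _ (ih _ _) (ih _ _))

omit [IsStrictOrderedRing K] in
/-- Linearity of `E[f(ŝₙ)]` in `f` (scalars). -/
theorem ipExp_mul_left (F : Finset K) (c : ℕ → K) (n : ℕ) (a : K) (f : K → K) (s : K) :
    ipExp F c n (fun t => a * f t) s = a * ipExp F c n f s := by
  induction n generalizing c s with
  | zero => rfl
  | succ n ih =>
      simp only [ipExp, ipStep]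
      rw [← step_mul_left]
      refine step_congr F _ ?_ ?_ <;> (rw [← step_mul_left]; exact step_congr F _ (ih _ _) (ih _ _))

/-- Monotonicity of `E[f(ŝₙ)]` in `f`. -/
theorem ipExp_mono (F : Finset K) (c : ℕ → K) (n : ℕ) {f g : K → K} (h : ∀ t, f t ≤ g t) (s : K) :
    ipExp F c n f s ≤ ipExp F c n g s := by
  induction n generalizing c s with
  | zero => exact h s
  | succ n ih =>
      simp only [ipExp, ipStep]
      exact step_mono F _ (fun a => step_mono F _ (fun t => ih _ t))

omit [IsStrictOrderedRing K] in
/-- An affine observable through one SR step: `E[SR(c) + b] = c̄ + b`. -/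
theorem step_add_const (F : Finset K) (c b : K) : step F c (fun t => t + b) = clamp F c + b := by
  rw [← step_id F c]; unfold step; ring

/-! ### Mean: exact, and unbiased iff-style criterion via no-saturation -/

omit [IsStrictOrderedRing K] in
/-- **Inner-product unbiasedness (finite format).** If no product and no pre-rounding sum saturates on
any branch, `E[ŝₙ] = s + ∑_{k<n} cₖ` exactly: CHM21 Thm 4.13 (inner products, `cₖ = xₖyₖ`) with
"no overflow" made precise as `IPNoSat` and no underflow hypothesis. -/
theorem ipExp_id_of_noSat (F : Finset K) :
    ∀ (n : ℕ) (c : ℕ → K) (s : K), IPNoSat F c n s →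
      ipExp F c n (fun t => t) s = s + ∑ k ∈ range n, c k := by
  intro n
  induction n with
  | zero => intro c s _; simp [ipExp]
  | succ n ih =>
      intro c s h
      obtain ⟨hc, ⟨hu, hu1, hu2⟩, ⟨hd, hd1, hd2⟩⟩ := h
      simp only [ipExp, ipStep]
      rw [sum_range_succ' c n]
      set S := ∑ k ∈ range n, c (k + 1) with hS
      have inner : ∀ b, InHull F (s + b) → IPNoSat F (fun i => c (i + 1)) n (up F (s + b)) →
          IPNoSat F (fun i => c (i + 1)) n (dn F (s + b)) →
          step F (s + b) (ipExp F (fun i => c (i + 1)) n (fun t => t)) = b + (s + S) := by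
        intro b hb h1 h2
        rw [step_congr F (s + b) (f := ipExp F (fun i => c (i + 1)) n (fun t => t))
          (g := fun t => t + S) (ih _ _ h1) (ih _ _ h2), step_add_const, clamp_eq_self hb]
        ring
      rw [step_congr F (c 0) (f := fun b => step F (s + b) (ipExp F (fun i => c (i + 1)) n (fun t => t)))
        (g := fun b => b + (s + S)) (inner _ hu hu1 hu2) (inner _ hd hd1 hd2), step_add_const,
        clamp_eq_self hc]
      ring

/-! ### Variance: the exact identity and its growth -/

/-- **Exact variance identity (inner products).** Without saturation, for every centre `a`,
`E[(ŝₙ − a)²] = ipVar + (s + ∑ cₖ − a)²`. -/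
theorem ipExp_sq_sub (F : Finset K) :
    ∀ (n : ℕ) (c : ℕ → K) (s : K), IPNoSat F c n s → ∀ a : K,
      ipExp F c n (fun t => (t - a) ^ 2) s = ipVar F c n s + (s + ∑ k ∈ range n, c k - a) ^ 2 := by
  intro n
  induction n with
  | zero => intro c s _ a; simp [ipExp, ipVar]
  | succ n ih =>
      intro c s h a
      obtain ⟨hc, ⟨hu, hu1, hu2⟩, ⟨hd, hd1, hd2⟩⟩ := h
      simp only [ipExp, ipVar, ipStep]
      rw [sum_range_succ' c n]
      set S := ∑ k ∈ range n, c (k + 1) with hS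
      have inner : ∀ b, InHull F (s + b) → IPNoSat F (fun i => c (i + 1)) n (up F (s + b)) →
          IPNoSat F (fun i => c (i + 1)) n (dn F (s + b)) →
          step F (s + b) (ipExp F (fun i => c (i + 1)) n (fun t => (t - a) ^ 2))
            = step F (s + b) (ipVar F (fun i => c (i + 1)) n) + srVar F (clamp F (s + b))
              + (b + (s + S - a)) ^ 2 := by
        intro b hb h1 h2
        rw [step_congr F (s + b) (f := ipExp F (fun i => c (i + 1)) n (fun t => (t - a) ^ 2))
          (g := fun t => ipVar F (fun i => c (i + 1)) n t + (t + (S - a)) ^ 2)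
          (by rw [ih _ _ h1]; ring) (by rw [ih _ _ h2]; ring), step_add, step_sq_add, clamp_eq_self hb]
        ring
      rw [step_congr F (c 0)
        (f := fun b => step F (s + b) (ipExp F (fun i => c (i + 1)) n (fun t => (t - a) ^ 2)))
        (g := fun b => step F (s + b) (ipVar F (fun i => c (i + 1)) n) + srVar F (clamp F (s + b))
          + (b + (s + S - a)) ^ 2) (inner _ hu hu1 hu2) (inner _ hd hd1 hd2),
        step_add, step_add, step_sq_add, clamp_eq_self hc]
      ring

/-- The variance about the exact inner product. -/
theorem ipExp_sq_sub_sum (F : Finset K) (c : ℕ → K) (n : ℕ) (s : K) (h : IPNoSat F c n s) :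
    ipExp F c n (fun t => (t - (s + ∑ k ∈ range n, c k)) ^ 2) s = ipVar F c n s := by
  rw [ipExp_sq_sub F n c s h, sub_self, zero_pow two_ne_zero, add_zero]

/-- one-step variance from a gap bound -/
theorem srVar_clamp_le_of_gap (F : Finset K) (c G : K)
    (hg : roundUp F (clamp F c) - roundDown F (clamp F c) ≤ G) : srVar F (clamp F c) ≤ G ^ 2 / 4 := by
  refine (srVar_le_gap_sq_div_four F _).trans ?_
  have h0 : 0 ≤ roundUp F (clamp F c) - roundDown F (clamp F c) :=
    sub_nonneg.mpr (roundDown_le_roundUp F _)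
  have := mul_self_le_mul_self h0 hg
  nlinarith [this]

/-- **Variance growth (inner products).** With product gaps `≤ Gp` and sum gaps `≤ Gs` on every
branch, `ipVar ≤ n (Gp² + Gs²)/4`. -/
theorem ipVar_le (F : Finset K) (Gp Gs : K) :
    ∀ (n : ℕ) (c : ℕ → K) (s : K), IPGapLE F Gp Gs c n s →
      ipVar F c n s ≤ n * ((Gp ^ 2 + Gs ^ 2) / 4) := by
  intro n
  induction n with
  | zero => intro c s _; simp [ipVar]
  | succ n ih =>
      intro c s h
      obtain ⟨hgp, ⟨hgu, hu1, hu2⟩, ⟨hgd, hd1, hd2⟩⟩ := h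
      simp only [ipVar, ipStep]
      have h1 : srVar F (clamp F (c 0)) ≤ Gp ^ 2 / 4 := srVar_clamp_le_of_gap F _ _ hgp
      have h2 : step F (c 0) (fun a => srVar F (clamp F (s + a))) ≤ Gs ^ 2 / 4 :=
        step_le_of F _ (srVar_clamp_le_of_gap F _ _ hgu) (srVar_clamp_le_of_gap F _ _ hgd)
      have h3 : step F (c 0) (fun a => step F (s + a) (ipVar F (fun i => c (i + 1)) n))
          ≤ n * ((Gp ^ 2 + Gs ^ 2) / 4) :=
        step_le_of F _ (step_le_of F _ (ih _ _ hu1) (ih _ _ hu2))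
          (step_le_of F _ (ih _ _ hd1) (ih _ _ hd2))
      push_cast
      linarith

/-- **Inner-product √n law (Bienaymé–Chebyshev).** Without saturation,
`P(|ŝₙ − (s + ∑ cₖ)| ≥ t) ≤ ipVar / t²`. -/
theorem ipExp_prob_dev_ge_le_ipVar (F : Finset K) (c : ℕ → K) (n : ℕ) (s : K) (h : IPNoSat F c n s)
    {t : K} (ht : 0 < t) :
    ipExp F c n (devInd t (s + ∑ k ∈ range n, c k)) s ≤ ipVar F c n s / t ^ 2 := by
  calc ipExp F c n (devInd t (s + ∑ k ∈ range n, c k)) s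
      ≤ ipExp F c n (fun v => (t ^ 2)⁻¹ * (v - (s + ∑ k ∈ range n, c k)) ^ 2) s :=
        ipExp_mono F c n (fun v => by
          rw [← div_eq_inv_mul]; exact devInd_le_sq_div t _ v ht) s
    _ = ipVar F c n s / t ^ 2 := by
        rw [ipExp_mul_left, ipExp_sq_sub_sum F c n s h, div_eq_inv_mul]

/-- **Inner-product envelope.** Without saturation and with branch-wise gaps `≤ Gp` (products),
`≤ Gs` (sums): `P(|ŝₙ − (s + ∑ cₖ)| ≥ t) ≤ n (Gp² + Gs²)/(4 t²)`. -/
theorem ipExp_prob_dev_ge_le (F : Finset K) (Gp Gs : K) (c : ℕ → K) (n : ℕ) (s : K)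
    (h : IPNoSat F c n s) (hg : IPGapLE F Gp Gs c n s) {t : K} (ht : 0 < t) :
    ipExp F c n (devInd t (s + ∑ k ∈ range n, c k)) s ≤ n * ((Gp ^ 2 + Gs ^ 2) / 4) / t ^ 2 :=
  (ipExp_prob_dev_ge_le_ipVar F c n s h ht).trans
    (div_le_div_of_nonneg_right (ipVar_le F Gp Gs n c s hg) (pow_pos ht 2).le)

end Summit.Ventures.CertifiedArithmetic.LowPrec.SR

/-! ### FP4 kernel instances -/

namespace Summit.Ventures.CertifiedArithmetic.LowPrec.SR.FP4

open Summit.Ventures.CertifiedArithmetic.LowPrec.SR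

/-- E2M1 inner product `x = (3/2, 1/2, −1)`, `y = (3/2, 3, 6)`: products `(9/4, 3/2, −6)` (the first is
not representable), no saturation on any branch; `E[ŝ₃] = 9/4 + 3/2 − 6 = −9/4` exactly. -/
theorem ip_triple_mean_witness :
    ipExp e2m1 (seq3 (9/4) (3/2) (-6)) 3 (fun t => t) 0 = -9/4 := by decide +kernel

/-- The same instance obtained from the theorem (hypothesis checked by the kernel). -/
example : ipExp e2m1 (seq3 (9/4) (3/2) (-6)) 3 (fun t => t) 0 = 0 + ((9/4 : ℚ) + (3/2 + (-6 + 0))) := by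
  have h := ipExp_id_of_noSat e2m1 3 (seq3 (9/4) (3/2) (-6)) 0 (by decide +kernel)
  rw [h]; decide +kernel

/-- Its exact variance: `Var ŝ₃ = ipVar = 9/16` (kernel evaluation), well within the envelope
`3·(1 + 4)/4` (product gaps `≤ 1`, sum gaps `≤ 2` on every branch, checked by the kernel below). -/
theorem ip_triple_var_witness : ipVar e2m1 (seq3 (9/4) (3/2) (-6)) 3 0 = 9/16 := by decide +kernel

/-- The gap hypotheses of the envelope hold on this instance (kernel decision). -/
example : IPGapLE e2m1 1 2 (seq3 (9/4) (3/2) (-6)) 3 0 := by decide +kernel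

/-- A saturating instance: products `(6, 6, −6)` from `0`: the sum `12` saturates to `6` on the way,
so `E[ŝ₃] = 0 ≠ 6 = ∑ cₖ` — the bias is the saturation defect, exactly as for plain summation. -/
theorem ip_triple_sat_witness :
    ipExp e2m1 (seq3 6 6 (-6)) 3 (fun t => t) 0 = 0 := by decide +kernel

end Summit.Ventures.CertifiedArithmetic.LowPrec.SR.FP4
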